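import Literature.NumberTheory.ComplexMultiplication.CMTypeSpecialElementReflexField
import HarnessLib

/-!
# The signature of a CM type over an imaginary quadratic subfield is a Galois-class invariant up to `a ↔ n − a`
# (Dodson 1984 §3.1.1: «the `G`-orbit of `f` is `G₀*(f) ∪ G₀*(ρf)`»); every signature occurs; at least
# `⌊n/2⌋ + 1` Galois classes; the reflex field contains `k₀` when the signature is unbalanced

Layer `Literature/NumberTheory/ComplexMultiplication`, namespace `Literature.NumberTheory.ComplexMultiplication` (lane
`lit-hodgefound`, Track 2 foundations, Layer A3; seat `lit-hodgefound-p11`, generation 26, row g26-#2).  Sequel of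
`CMTypeSpecialElementReflexField` (g25-#6: Howard's special element = signature `(n − 1, 1)`), in the COMPLEX MODEL
(`Φ : CMType K`, `Aut(ℂ)` acting on `Hom(K, ℂ)`, Galois classes `cmTypeGaloisSetoid K`, reflex field `traceField Φ`).
THEOREMS ONLY: no definition, no named fact (D-0026), net Literature debt 0.

THE PRINT.  B. Dodson, *The structure of Galois groups of CM-fields*, Trans. AMS 283 (1984) [Dodson1984], §3.1.0
(held `paper:doi-10-2307-1999987`, p. 11): «the weight of `f ∈ (ℤ₂)ⁿ`, `f = (f₁, …, fₙ)` will refer to the sum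
`f₁ + ⋯ + fₙ`», and §3.1.1 Theorem, proof (p. 12): «Let `D` be an imaginary quadratic subfield of `K`.  Then `Kᶜ` is
the composite `Kᶜ = DK₀ᶜ` […] so that **the `G`-orbit of `f` is `G₀*(f) ∪ G₀*(ρf)`** […] the weight `w = weight(v)`
is constant for `v ∈ G₀*(f)`».  In words: a CM type `Φ` of a CM field `K ⊇ k₀` (`[K : ℚ] = 2n`, `k₀` imaginary
quadratic with embedding `ψ`) is the datum of its trace `Φ ∩ F_ψ` on the fibre `F_ψ` of `Hom(K, ℂ) → Hom(k₀, ℂ)`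
above `ψ` (an arbitrary subset: `2ⁿ` types), its SIGNATURE is `(a, n − a)`, `a = #(Φ ∩ F_ψ)` (Dodson's weight is
`n − a`), and the Galois conjugates `τΦ` have signature `(a, n − a)` or `(n − a, a)` according as `τ` fixes or
conjugates `ψ`.  B. Howard, Ann. of Math. 176 (2012) [Howard2012] §3.1: signature `(n − 1, 1)` = «a unique
`φ^sp ∈ Φ` whose restriction to `K₀` is `ῑ`», and `K_Φ ⊇ K₀`.  G. Shimura (1998) [Shimura1998] §8.3 Prop. 28
(`K* = ℚ(tr_Φ)` and the stabiliser of `Φ`), §8.4 (1) (the two types of an imaginary quadratic field).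

THE TREE already carries the GROUP-LEVEL form of «`G₀*(f) ∪ G₀*(ρf)`» (`IsCMTypeWith.exists_smul_set_inter_eq` of
`ReflexDegreeQuadraticSubfieldBound`, carrier (W): an abstract `G` acting on `E` with a block `E₀`) and the reflex
degree bound `[K′ : ℚ] ≤ C(n,a) + C(n,b)`; here the same mechanism is read directly in the complex model and turned
into statements about GALOIS CLASSES and the REFLEX FIELD that the field-level files of this lineage consume.  The
multiplicity `a` is written `{φ : K →+* ℂ | φ ∈ Φ.1 ∧ φ.comp (algebraMap k₀ K) = ψ}.ncard` (the spelling of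
`ReflexDegreeQuadraticSubfieldBound.finrank_reflexField_le_choose_add_choose_of_ringHom`).

WHAT IS PROVED (all `sorry`-free; `k₀ : IntermediateField ℚ K`, `[IsTotallyComplex k₀]`, `finrank ℚ k₀ = 2`;
`[IsCMField K]` where the `Aut(ℂ)`-action on CM types is used).

§1 `ncard_fibre_eq_finrank` (`#F_ψ = [K : k₀]`), **`ncard_inter_fibre_add_ncard_inter_fibre_conjugate`**
   (`a + b = n`: conjugation maps `F_ψ ∖ Φ` onto `Φ ∩ F_ψ̄`), `ncard_inter_fibre_le`, `ncard_inter_fibre_conjugate_eq`.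
§2 `ncard_inter_fibre_cmTypeSmul` (the `ψ`-multiplicity of `τΦ` is the `τ⁻¹ψ`-multiplicity of `Φ`),
   **`ncard_inter_fibre_cmTypeSmul_eq_or`** («`G₀*(f) ∪ G₀*(ρf)`»: it is `a` or `n − a`),
   **`min_ncard_inter_fibre_eq_of_galoisRel`** (the unordered signature is a Galois-class invariant),
   `not_galoisRel_of_ncard_inter_fibre_ne`.
§3 **`exists_cmType_inter_fibre_eq`** (every `S ⊆ F_ψ` is the `ψ`-trace of the CM type `S ∪ \overline{F_ψ ∖ S}`),
   `exists_cmType_ncard_inter_fibre_eq` (every signature `0 ≤ a ≤ n` occurs), `eq_of_inter_fibre_eq` (a type is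
   determined by its `ψ`-trace).
§4 **`finrank_div_two_succ_le_card_cmTypeGaloisClasses`: at least `⌊n/2⌋ + 1` Galois classes of CM types**
   (`finrank_div_four_succ_le_card_cmTypeGaloisClasses` in terms of `[K : ℚ]`; octic: `≥ 3`, duodecic: `≥ 4`).
§5 the extreme signatures: `exists_inducedCMType_eq_of_ncard_inter_fibre_eq_finrank` / `…_eq_zero` (signature
   `{0, n}` ⟹ induced from `k₀`) and `ncard_inter_fibre_inducedCMType_eq_or` (conversely);
   `ncard_inter_fibre_eq_one_iff_exists_special` (signature `(1, n − 1)` over `ψ` ⟺ a special element above `ψ`),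
   **`galoisRel_of_ncard_inter_fibre_mem_pair`** (the types of signature `{1, n − 1}` form ONE Galois class,
   `[K : ℚ] ≥ 6`), `not_galoisRel_of_two_le_ncard_inter_fibre` (`2 ≤ a ≤ n − 2`: in neither extreme class).
§6 **`fieldRange_le_traceField_of_two_mul_ncard_ne`: `2a ≠ n ⟹ ψ(k₀) ⊆ K*`** (an automorphism of `ℂ` fixing `K*`
   fixes `Φ` and so cannot swap `ψ` and `ψ̄`), `fieldRange_le_traceField_of_special` (Howard's `K_Φ ⊇ K₀`), and
   `two_mul_ncard_inter_fibre_eq_of_not_le` (`K* ⊉ ψ(k₀)` forces the balanced signature `2a = n` — Weil type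
   relative to `k₀`).

## References

* [Dodson1984] B. Dodson, *The structure of Galois groups of CM-fields*, Trans. AMS 283 (1984), §3.1.0 and §3.1.1
  Theorem with proof (pp. 11–12).
* [Howard2012] B. Howard, *Complex multiplication cycles and Kudla–Rapoport divisors*, Ann. of Math. (2) 176 (2012),
  §3.1.
* [Shimura1998] G. Shimura, *Abelian Varieties with Complex Multiplication and Modular Functions* (1998), §8.3
  Prop. 28, §8.4 Example (1).
* [DinaIonicaSijsling2022] B. Dina, S. Ionica, J. Sijsling (2022), §1.3 Prop. 16.
* [MilneFT2022] J. S. Milne, *Fields and Galois Theory* (2022), Prop. 2.7.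

## Provenance

Lane `lit-hodgefound` (HOME `run/shared/lean/pub/lit-hodgefound/`), prover seat `lit-hodgefound-p11` (gen 26),
self-proposed row g26-#2 (INBOX claim 2026-08-27, l.41491), successor pointer (s2) of the gen-25 closing line.
-/

set_option autoImplicit false

noncomputable section

open scoped Classical NumberField Pointwise
open NumberField Module IntermediateField

namespace Literature.NumberTheory.ComplexMultiplication

open Literature.AlgebraicGeometry.Motives (CMType)
open Literature.AlgebraicGeometry.Motives.HodgeStructure (cmTypeSmul cmTypeSmul_val)
open Literature.AlgebraicGeometry.Pohlmann1968 (isPretransitive_ringEquiv_complex card_fibre_eq_finrank)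

variable {K : Type} [Field K] [NumberField K] (k₀ : IntermediateField ℚ K)

/-! ## §0 Preliminaries -/

section Prelim

/-- `(τφ)|_{k₀} = τ(φ|_{k₀})`. [folklore] -/
private theorem smul_comp_sg (τ : ℂ ≃+* ℂ) (φ : K →+* ℂ) :
    (τ • φ).comp (algebraMap k₀ K) = τ • φ.comp (algebraMap k₀ K) :=
  RingHom.ext fun _ => rfl

/-- `φ̄|_{k₀} = \overline{φ|_{k₀}}`. [folklore] -/
private theorem conjugate_comp_sg (φ : K →+* ℂ) :
    (ComplexEmbedding.conjugate φ).comp (algebraMap k₀ K) = ComplexEmbedding.conjugate (φ.comp (algebraMap k₀ K)) :=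
  (conjugate_comp_ringHom (algebraMap k₀ K) φ).symm

variable [IsTotallyComplex k₀]

/-- `ψ̄ ≠ ψ`. [folklore] -/
private theorem conjugate_ne_sg (ψ : k₀ →+* ℂ) : ComplexEmbedding.conjugate ψ ≠ ψ := fun h =>
  IsTotallyComplex.complexEmbedding_not_isReal ψ (ComplexEmbedding.isReal_iff.2 h)

/-- `[k₀ : ℚ] = 2`: every complex embedding of `k₀` is `ψ` or `ψ̄`. [cite: Shimura1998, §8.4 (1)] -/
private theorem eq_or_eq_conjugate_sg (hk₀ : finrank ℚ k₀ = 2) (ψ χ : k₀ →+* ℂ) :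
    χ = ψ ∨ χ = ComplexEmbedding.conjugate ψ := by
  by_contra h
  push Not at h
  have h3 := Fintype.two_lt_card_iff.2 ⟨χ, ψ, ComplexEmbedding.conjugate ψ, h.1, h.2, (conjugate_ne_sg k₀ ψ).symm⟩
  rw [Embeddings.card, hk₀] at h3
  exact lt_irrefl _ h3

end Prelim

/-! ## §1 The fibres of `Hom(K, ℂ) → Hom(k₀, ℂ)` and the signature `(a, b)` of a CM type over `ψ` -/

section Fibre

/-- `#{φ | φ|_{k₀} = ψ} = [K : k₀]`. [cite: MilneFT2022, Prop. 2.7 (a)] -/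
theorem ncard_fibre_eq_finrank (ψ : k₀ →+* ℂ) :
    {φ : K →+* ℂ | φ.comp (algebraMap k₀ K) = ψ}.ncard = finrank k₀ K := by
  rw [← card_fibre_eq_finrank (K := K) (k := k₀) ψ, Set.ncard_eq_toFinset_card', Set.toFinset_setOf]

/-- `[K : k₀] = [K : ℚ]/2` for `[k₀ : ℚ] = 2` (tower law). [folklore] -/
private theorem finrank_eq_finrank_div_two (hk₀ : finrank ℚ k₀ = 2) : finrank k₀ K = finrank ℚ K / 2 := by
  have h := Module.finrank_mul_finrank ℚ k₀ K
  rw [hk₀] at h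
  omega

/-- **`a + b = n`**: the multiplicities `a = #{φ ∈ Φ | φ|_{k₀} = ψ}`, `b = #{φ ∈ Φ | φ|_{k₀} = ψ̄}` of a CM type over the
two embeddings of `k₀` add up to `[K : k₀]` — conjugation is a bijection from the members of the `ψ`-fibre OUTSIDE `Φ`
onto the members of `Φ` above `ψ̄`. [cite: Dodson1984, §3.1.0–3.1.1 (the weight of `f`)] [cite: Shimura1998, §8.4 (1)] -/
theorem ncard_inter_fibre_add_ncard_inter_fibre_conjugate (Φ : CMType K) (ψ : k₀ →+* ℂ) :
    {φ : K →+* ℂ | φ ∈ Φ.1 ∧ φ.comp (algebraMap k₀ K) = ψ}.ncard +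
      {φ : K →+* ℂ | φ ∈ Φ.1 ∧ φ.comp (algebraMap k₀ K) = ComplexEmbedding.conjugate ψ}.ncard = finrank k₀ K := by
  have himg : {φ : K →+* ℂ | φ ∈ Φ.1 ∧ φ.comp (algebraMap k₀ K) = ComplexEmbedding.conjugate ψ} =
      ComplexEmbedding.conjugate '' {φ : K →+* ℂ | φ ∉ Φ.1 ∧ φ.comp (algebraMap k₀ K) = ψ} := by
    ext φ
    simp only [Set.mem_setOf_eq, Set.mem_image]
    constructor
    · rintro ⟨hφ, hψ⟩
      refine ⟨ComplexEmbedding.conjugate φ, ⟨(Φ.2 φ).1 hφ, ?_⟩, ComplexEmbedding.involutive_conjugate K φ⟩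
      rw [conjugate_comp_sg, hψ]
      exact ComplexEmbedding.involutive_conjugate _ ψ
    · rintro ⟨χ, ⟨hχ, hχψ⟩, rfl⟩
      refine ⟨?_, by rw [conjugate_comp_sg, hχψ]⟩
      by_contra h
      exact hχ ((Φ.2 χ).2 h)
  rw [himg, Set.ncard_image_of_injective _ (ComplexEmbedding.involutive_conjugate K).injective,
    ← Set.ncard_union_eq (Set.disjoint_left.2 fun φ h1 h2 => h2.1 h1.1), ← ncard_fibre_eq_finrank k₀ ψ]
  congr 1
  ext φ
  simp only [Set.mem_union, Set.mem_setOf_eq]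
  tauto

/-- `a ≤ n` (the weight of `f ∈ (ℤ₂)ⁿ` is at most `n`). [cite: Dodson1984, §3.1.0 (p. 11)] -/
theorem ncard_inter_fibre_le (Φ : CMType K) (ψ : k₀ →+* ℂ) :
    {φ : K →+* ℂ | φ ∈ Φ.1 ∧ φ.comp (algebraMap k₀ K) = ψ}.ncard ≤ finrank k₀ K := by
  have h := ncard_inter_fibre_add_ncard_inter_fibre_conjugate k₀ Φ ψ
  omega

/-- The multiplicity over `ψ̄` is `n − a`. [cite: Dodson1984, §3.1.1 Theorem (proof)] -/
theorem ncard_inter_fibre_conjugate_eq (Φ : CMType K) (ψ : k₀ →+* ℂ) :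
    {φ : K →+* ℂ | φ ∈ Φ.1 ∧ φ.comp (algebraMap k₀ K) = ComplexEmbedding.conjugate ψ}.ncard =
      finrank k₀ K - {φ : K →+* ℂ | φ ∈ Φ.1 ∧ φ.comp (algebraMap k₀ K) = ψ}.ncard := by
  have h := ncard_inter_fibre_add_ncard_inter_fibre_conjugate k₀ Φ ψ
  omega

end Fibre

/-! ## §2 «The `G`-orbit of `f` is `G₀*(f) ∪ G₀*(ρf)`»: the unordered signature is a Galois-class invariant -/

section Galois

variable [IsCMField K]

/-- The `ψ`-multiplicity of `τΦ` is the `τ⁻¹ψ`-multiplicity of `Φ` (`φ ↦ τφ` maps the one fibre onto the other).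
[cite: Dodson1984, §3.1.1 Theorem (proof)] -/
theorem ncard_inter_fibre_cmTypeSmul (τ : ℂ ≃+* ℂ) (Φ : CMType K) (ψ : k₀ →+* ℂ) :
    {φ : K →+* ℂ | φ ∈ (cmTypeSmul τ Φ).1 ∧ φ.comp (algebraMap k₀ K) = ψ}.ncard =
      {φ : K →+* ℂ | φ ∈ Φ.1 ∧ φ.comp (algebraMap k₀ K) = τ⁻¹ • ψ}.ncard := by
  have himg : {φ : K →+* ℂ | φ ∈ (cmTypeSmul τ Φ).1 ∧ φ.comp (algebraMap k₀ K) = ψ} =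
      (fun χ : K →+* ℂ => τ • χ) '' {φ : K →+* ℂ | φ ∈ Φ.1 ∧ φ.comp (algebraMap k₀ K) = τ⁻¹ • ψ} := by
    ext φ
    simp only [Set.mem_setOf_eq, Set.mem_image, cmTypeSmul_val]
    constructor
    · rintro ⟨hφ, hψ⟩
      refine ⟨τ⁻¹ • φ, ⟨Set.mem_smul_set_iff_inv_smul_mem.1 hφ, ?_⟩, smul_inv_smul τ φ⟩
      rw [smul_comp_sg, hψ]
    · rintro ⟨χ, ⟨hχ, hχψ⟩, rfl⟩
      exact ⟨Set.smul_mem_smul_set hχ, by rw [smul_comp_sg, hχψ, smul_inv_smul]⟩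
  rw [himg, Set.ncard_image_of_injective _ (MulAction.injective τ)]

variable [IsTotallyComplex k₀]

/-- **DODSON: «the `G`-orbit of `f` is `G₀*(f) ∪ G₀*(ρf)`» — the `ψ`-multiplicity of a Galois conjugate `τΦ` is `a` or
`n − a`**, `a` the `ψ`-multiplicity of `Φ` (as `τ⁻¹ψ ∈ {ψ, ψ̄}`). [cite: Dodson1984, §3.1.1 Theorem (proof, p. 12)] -/
theorem ncard_inter_fibre_cmTypeSmul_eq_or (hk₀ : finrank ℚ k₀ = 2) (τ : ℂ ≃+* ℂ) (Φ : CMType K) (ψ : k₀ →+* ℂ) :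
    {φ : K →+* ℂ | φ ∈ (cmTypeSmul τ Φ).1 ∧ φ.comp (algebraMap k₀ K) = ψ}.ncard =
        {φ : K →+* ℂ | φ ∈ Φ.1 ∧ φ.comp (algebraMap k₀ K) = ψ}.ncard ∨
      {φ : K →+* ℂ | φ ∈ (cmTypeSmul τ Φ).1 ∧ φ.comp (algebraMap k₀ K) = ψ}.ncard =
        finrank k₀ K - {φ : K →+* ℂ | φ ∈ Φ.1 ∧ φ.comp (algebraMap k₀ K) = ψ}.ncard := by
  rw [ncard_inter_fibre_cmTypeSmul k₀ τ Φ ψ]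
  rcases eq_or_eq_conjugate_sg k₀ hk₀ ψ (τ⁻¹ • ψ) with h | h
  · exact Or.inl (by rw [h])
  · exact Or.inr (by rw [h, ncard_inter_fibre_conjugate_eq])

/-- **The unordered signature `{a, n − a}` is a Galois-class invariant**: Galois equivalent CM types have the same
`min(a, n − a)` over every embedding `ψ` of `k₀` («the weight `w = weight(v)` is constant for `v ∈ G₀*(f)`», and
`G*(f) = G₀*(f) ∪ G₀*(ρf)`). [cite: Dodson1984, §3.1.1 Theorem (proof, p. 12)] -/
theorem min_ncard_inter_fibre_eq_of_galoisRel (hk₀ : finrank ℚ k₀ = 2) {Φ Ψ : CMType K}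
    (h : (cmTypeGaloisSetoid K).r Φ Ψ) (ψ : k₀ →+* ℂ) :
    min {φ : K →+* ℂ | φ ∈ Φ.1 ∧ φ.comp (algebraMap k₀ K) = ψ}.ncard
        (finrank k₀ K - {φ : K →+* ℂ | φ ∈ Φ.1 ∧ φ.comp (algebraMap k₀ K) = ψ}.ncard) =
      min {φ : K →+* ℂ | φ ∈ Ψ.1 ∧ φ.comp (algebraMap k₀ K) = ψ}.ncard
        (finrank k₀ K - {φ : K →+* ℂ | φ ∈ Ψ.1 ∧ φ.comp (algebraMap k₀ K) = ψ}.ncard) := by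
  obtain ⟨τ, rfl⟩ := h
  have hle := ncard_inter_fibre_le k₀ Φ ψ
  rcases ncard_inter_fibre_cmTypeSmul_eq_or k₀ hk₀ τ Φ ψ with h1 | h1
  · rw [h1]
  · rw [h1, Nat.sub_sub_self hle, min_comm]

/-- Contrapositive: two CM types whose `ψ`-multiplicities `a`, `a'` satisfy `a' ∉ {a, n − a}` are NOT Galois
equivalent (they have different reflex data). [cite: Dodson1984, §3.1.1 Theorem (proof, p. 12)] -/
theorem not_galoisRel_of_ncard_inter_fibre_ne (hk₀ : finrank ℚ k₀ = 2) {Φ Ψ : CMType K} (ψ : k₀ →+* ℂ)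
    (h₁ : {φ : K →+* ℂ | φ ∈ Ψ.1 ∧ φ.comp (algebraMap k₀ K) = ψ}.ncard ≠
      {φ : K →+* ℂ | φ ∈ Φ.1 ∧ φ.comp (algebraMap k₀ K) = ψ}.ncard)
    (h₂ : {φ : K →+* ℂ | φ ∈ Ψ.1 ∧ φ.comp (algebraMap k₀ K) = ψ}.ncard ≠
      finrank k₀ K - {φ : K →+* ℂ | φ ∈ Φ.1 ∧ φ.comp (algebraMap k₀ K) = ψ}.ncard) :
    ¬ (cmTypeGaloisSetoid K).r Φ Ψ := by
  rintro ⟨τ, rfl⟩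
  rcases ncard_inter_fibre_cmTypeSmul_eq_or k₀ hk₀ τ Φ ψ with h | h
  · exact h₁ h
  · exact h₂ h

end Galois

/-! ## §3 Every signature occurs: the CM type attached to a subset of the `ψ`-fibre -/

section Existence

variable [IsTotallyComplex k₀]

/-- Membership in `Φ_S = S ∪ \overline{F_ψ ∖ S}` above `ψ`: exactly `S`. [cite: Dodson1984, §3.1.0 («`Φ = Φᶠ, f ∈ (ℤ₂)ⁿ`»)] -/
private theorem mem_typeOfSubset_iff_of_fibre {S : Set (K →+* ℂ)} {ψ : k₀ →+* ℂ}
    {φ : K →+* ℂ} (hφ : φ.comp (algebraMap k₀ K) = ψ) :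
    φ ∈ S ∪ ComplexEmbedding.conjugate '' ({φ : K →+* ℂ | φ.comp (algebraMap k₀ K) = ψ} \ S) ↔ φ ∈ S := by
  refine ⟨fun h => ?_, fun h => Or.inl h⟩
  rcases h with h | ⟨χ, ⟨hχ, -⟩, rfl⟩
  · exact h
  · exfalso
    rw [conjugate_comp_sg, show χ.comp (algebraMap k₀ K) = ψ from hχ] at hφ
    exact conjugate_ne_sg k₀ ψ hφ

/-- Membership in `Φ_S` above `ψ̄`: `φ ∈ Φ_S ⟺ φ̄ ∉ S`. [cite: Dodson1984, §3.1.0] -/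
private theorem mem_typeOfSubset_iff_of_fibre_conjugate {S : Set (K →+* ℂ)} {ψ : k₀ →+* ℂ}
    (hS : S ⊆ {φ : K →+* ℂ | φ.comp (algebraMap k₀ K) = ψ}) {φ : K →+* ℂ}
    (hφ : φ.comp (algebraMap k₀ K) = ComplexEmbedding.conjugate ψ) :
    φ ∈ S ∪ ComplexEmbedding.conjugate '' ({φ : K →+* ℂ | φ.comp (algebraMap k₀ K) = ψ} \ S) ↔
      ComplexEmbedding.conjugate φ ∉ S := by
  have hφ' : (ComplexEmbedding.conjugate φ).comp (algebraMap k₀ K) = ψ := by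
    rw [conjugate_comp_sg, hφ]
    exact ComplexEmbedding.involutive_conjugate _ ψ
  constructor
  · rintro (h | ⟨χ, ⟨-, hχS⟩, rfl⟩)
    · exfalso
      have h1 : φ.comp (algebraMap k₀ K) = ψ := hS h
      rw [h1] at hφ
      exact conjugate_ne_sg k₀ ψ hφ.symm
    · rwa [ComplexEmbedding.involutive_conjugate K χ]
  · intro h
    exact Or.inr ⟨ComplexEmbedding.conjugate φ, ⟨hφ', h⟩, ComplexEmbedding.involutive_conjugate K φ⟩

/-- **Every subset `S` of the `ψ`-fibre is the `ψ`-trace of a CM type**, namely `Φ_S = S ∪ \overline{F_ψ ∖ S}` (Dodson's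
`Φ = Φᶠ`, `f ∈ (ℤ₂)ⁿ`: a CM type of `K ⊇ k₀` is an arbitrary choice, above each of the `n` embeddings of `K⁺`… here:
above each member of the `ψ`-fibre, of that member or its conjugate). [cite: Dodson1984, §3.1.0–3.1.1] -/
theorem exists_cmType_inter_fibre_eq (hk₀ : finrank ℚ k₀ = 2) {S : Set (K →+* ℂ)} {ψ : k₀ →+* ℂ}
    (hS : S ⊆ {φ : K →+* ℂ | φ.comp (algebraMap k₀ K) = ψ}) :
    ∃ Φ : CMType K, {φ : K →+* ℂ | φ ∈ Φ.1 ∧ φ.comp (algebraMap k₀ K) = ψ} = S := by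
  refine ⟨⟨S ∪ ComplexEmbedding.conjugate '' ({φ : K →+* ℂ | φ.comp (algebraMap k₀ K) = ψ} \ S), fun φ => ?_⟩, ?_⟩
  · rcases eq_or_eq_conjugate_sg k₀ hk₀ ψ (φ.comp (algebraMap k₀ K)) with hφ | hφ
    · have hφbar : (ComplexEmbedding.conjugate φ).comp (algebraMap k₀ K) = ComplexEmbedding.conjugate ψ := by
        rw [conjugate_comp_sg, hφ]
      rw [mem_typeOfSubset_iff_of_fibre k₀ hφ, mem_typeOfSubset_iff_of_fibre_conjugate k₀ hS hφbar,
        ComplexEmbedding.involutive_conjugate K φ, not_not]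
    · have hφbar : (ComplexEmbedding.conjugate φ).comp (algebraMap k₀ K) = ψ := by
        rw [conjugate_comp_sg, hφ]
        exact ComplexEmbedding.involutive_conjugate _ ψ
      rw [mem_typeOfSubset_iff_of_fibre_conjugate k₀ hS hφ, mem_typeOfSubset_iff_of_fibre k₀ hφbar]
  · ext φ
    simp only [Set.mem_setOf_eq]
    constructor
    · rintro ⟨hmem, hφ⟩
      exact (mem_typeOfSubset_iff_of_fibre k₀ hφ).1 hmem
    · intro h
      exact ⟨Or.inl h, hS h⟩

/-- **Every signature `(a, n − a)`, `0 ≤ a ≤ n`, occurs** among the CM types of `K ⊇ k₀`.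
[cite: Dodson1984, §3.1.0–3.1.1] -/
theorem exists_cmType_ncard_inter_fibre_eq (hk₀ : finrank ℚ k₀ = 2) (ψ : k₀ →+* ℂ) {a : ℕ} (ha : a ≤ finrank k₀ K) :
    ∃ Φ : CMType K, {φ : K →+* ℂ | φ ∈ Φ.1 ∧ φ.comp (algebraMap k₀ K) = ψ}.ncard = a := by
  rw [← ncard_fibre_eq_finrank k₀ ψ] at ha
  obtain ⟨S, hS, hSa⟩ := Set.exists_subset_card_eq ha
  obtain ⟨Φ, hΦ⟩ := exists_cmType_inter_fibre_eq k₀ hk₀ hS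
  exact ⟨Φ, by rw [hΦ, hSa]⟩

/-- A CM type is determined by its `ψ`-trace `Φ ∩ F_ψ` (above `ψ̄` it consists of the conjugates of `F_ψ ∖ Φ`).
[cite: Dodson1984, §3.1.0 («`Φ = Φᶠ`»)] -/
theorem eq_of_inter_fibre_eq (hk₀ : finrank ℚ k₀ = 2) {Φ Ψ : CMType K} (ψ : k₀ →+* ℂ)
    (h : {φ : K →+* ℂ | φ ∈ Φ.1 ∧ φ.comp (algebraMap k₀ K) = ψ} =
      {φ : K →+* ℂ | φ ∈ Ψ.1 ∧ φ.comp (algebraMap k₀ K) = ψ}) : Φ = Ψ := by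
  have key : ∀ φ : K →+* ℂ, φ.comp (algebraMap k₀ K) = ψ → (φ ∈ Φ.1 ↔ φ ∈ Ψ.1) := fun φ hφ => by
    have h1 := Set.ext_iff.1 h φ
    simp only [Set.mem_setOf_eq, hφ, and_true] at h1
    exact h1
  refine Subtype.ext (Set.ext fun φ => ?_)
  rcases eq_or_eq_conjugate_sg k₀ hk₀ ψ (φ.comp (algebraMap k₀ K)) with hφ | hφ
  · exact key φ hφ
  · have hφbar : (ComplexEmbedding.conjugate φ).comp (algebraMap k₀ K) = ψ := by
      rw [conjugate_comp_sg, hφ]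
      exact ComplexEmbedding.involutive_conjugate _ ψ
    rw [Φ.2 φ, Ψ.2 φ, key _ hφbar]

end Existence

/-! ## §4 At least `⌊n/2⌋ + 1` Galois classes -/

section Classes

variable [IsCMField K] [IsTotallyComplex k₀]

/-- **A CM field of degree `2n` containing an imaginary quadratic field has AT LEAST `⌊n/2⌋ + 1` Galois classes of CM
types** — one for each unordered signature `{a, n − a}`, `0 ≤ a ≤ n/2`, which all occur (§3) and are Galois
invariants (§2). [cite: Dodson1984, §3.1.1 Theorem (proof, p. 12)] -/
theorem finrank_div_two_succ_le_card_cmTypeGaloisClasses (hk₀ : finrank ℚ k₀ = 2) :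
    finrank k₀ K / 2 + 1 ≤ Nat.card (Quotient (cmTypeGaloisSetoid K)) := by
  haveI := finite_cmTypeGaloisClasses (K := K)
  obtain ⟨ψ⟩ : Nonempty (k₀ →+* ℂ) := inferInstance
  -- a type of signature `a` for each `a ≤ n/2`
  have hex : ∀ a : Fin (finrank k₀ K / 2 + 1), ∃ Φ : CMType K,
      {φ : K →+* ℂ | φ ∈ Φ.1 ∧ φ.comp (algebraMap k₀ K) = ψ}.ncard = a := fun a =>
    exists_cmType_ncard_inter_fibre_eq k₀ hk₀ ψ (by have := a.2; omega)
  choose Φ hΦ using hex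
  let f : Fin (finrank k₀ K / 2 + 1) → Quotient (cmTypeGaloisSetoid K) := fun a => Quotient.mk _ (Φ a)
  have hf : Function.Injective f := by
    intro a b hab
    have hrel : (cmTypeGaloisSetoid K).r (Φ a) (Φ b) := Quotient.exact hab
    have hmin := min_ncard_inter_fibre_eq_of_galoisRel k₀ hk₀ hrel ψ
    rw [hΦ a, hΦ b] at hmin
    have ha := a.2
    have hb := b.2
    apply Fin.ext
    rw [min_eq_left (by omega), min_eq_left (by omega)] at hmin
    exact hmin
  have h := Nat.card_le_card_of_injective f hf
  rwa [Nat.card_eq_fintype_card, Fintype.card_fin] at h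

/-- The same bound in terms of `[K : ℚ] = 2n`: `#(Galois classes) ≥ [K : ℚ]/4 + 1`. [cite: Dodson1984, §3.1.1 Theorem (proof, p. 12)] -/
theorem finrank_div_four_succ_le_card_cmTypeGaloisClasses (hk₀ : finrank ℚ k₀ = 2) :
    finrank ℚ K / 4 + 1 ≤ Nat.card (Quotient (cmTypeGaloisSetoid K)) := by
  have h := finrank_div_two_succ_le_card_cmTypeGaloisClasses k₀ hk₀
  rw [finrank_eq_finrank_div_two k₀ hk₀, Nat.div_div_eq_div_mul] at h
  exact h

/-- **Octic CM fields containing an imaginary quadratic field have at least THREE Galois classes of CM types**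
(signatures `{4,0}`, `{3,1}`, `{2,2}`). [cite: Dodson1984, §3.1.1 Theorem (proof) and §3.3] -/
theorem three_le_card_cmTypeGaloisClasses_of_finrank_eq_eight (hk₀ : finrank ℚ k₀ = 2) (h8 : finrank ℚ K = 8) :
    3 ≤ Nat.card (Quotient (cmTypeGaloisSetoid K)) := by
  have h := finrank_div_four_succ_le_card_cmTypeGaloisClasses k₀ hk₀
  rw [h8] at h
  exact h

/-- Decic (`[K : ℚ] = 10`) and duodecic (`[K : ℚ] = 12`) CM fields containing an imaginary quadratic field have at
least `3`, resp. `4`, Galois classes. [cite: Dodson1984, §3.1.1 Theorem (proof)] -/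
theorem four_le_card_cmTypeGaloisClasses_of_finrank_eq_twelve (hk₀ : finrank ℚ k₀ = 2) (h12 : finrank ℚ K = 12) :
    4 ≤ Nat.card (Quotient (cmTypeGaloisSetoid K)) := by
  have h := finrank_div_four_succ_le_card_cmTypeGaloisClasses k₀ hk₀
  rw [h12] at h
  exact h

end Classes

/-! ## §5 The extreme signatures: `{0, n}` = induced from `k₀`, `{1, n − 1}` = special element -/

section Extreme

variable [IsTotallyComplex k₀]

/-- **Signature `(n, 0)`: the whole `ψ`-fibre lies in `Φ`, so `Φ` is induced from the CM type `{ψ}` of `k₀`.**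
[cite: Dodson1984, §3.1.1 (`f = 0`)] [cite: DinaIonicaSijsling2022, §1.3 Prop. 16] -/
theorem exists_inducedCMType_eq_of_ncard_inter_fibre_eq_finrank (hk₀ : finrank ℚ k₀ = 2) {Φ : CMType K}
    {ψ : k₀ →+* ℂ} (h : {φ : K →+* ℂ | φ ∈ Φ.1 ∧ φ.comp (algebraMap k₀ K) = ψ}.ncard = finrank k₀ K) :
    ∃ Ψ₀ : CMType k₀, inducedCMType (algebraMap k₀ K) Ψ₀ = Φ := by
  refine exists_inducedCMType_eq_of_fibre_subset k₀ hk₀ (ψ := ψ) fun φ hφ => ?_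
  have hsub : {φ : K →+* ℂ | φ ∈ Φ.1 ∧ φ.comp (algebraMap k₀ K) = ψ} ⊆
      {φ : K →+* ℂ | φ.comp (algebraMap k₀ K) = ψ} := fun φ hφ => hφ.2
  have heq := Set.eq_of_subset_of_ncard_le hsub (by rw [h, ncard_fibre_eq_finrank]) (Set.toFinite _)
  have hmem : φ ∈ {φ : K →+* ℂ | φ.comp (algebraMap k₀ K) = ψ} := hφ
  rw [← heq] at hmem
  exact hmem.1

/-- **Signature `(0, n)`**: no member of `Φ` above `ψ`, so the whole `ψ̄`-fibre lies in `Φ` and `Φ` is induced from `{ψ̄}`.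
[cite: Dodson1984, §3.1.1] [cite: DinaIonicaSijsling2022, §1.3 Prop. 16] -/
theorem exists_inducedCMType_eq_of_ncard_inter_fibre_eq_zero (hk₀ : finrank ℚ k₀ = 2) {Φ : CMType K}
    {ψ : k₀ →+* ℂ} (h : {φ : K →+* ℂ | φ ∈ Φ.1 ∧ φ.comp (algebraMap k₀ K) = ψ}.ncard = 0) :
    ∃ Ψ₀ : CMType k₀, inducedCMType (algebraMap k₀ K) Ψ₀ = Φ := by
  refine exists_inducedCMType_eq_of_ncard_inter_fibre_eq_finrank k₀ hk₀ (ψ := ComplexEmbedding.conjugate ψ) ?_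
  rw [ncard_inter_fibre_conjugate_eq, h, Nat.sub_zero]

omit [IsTotallyComplex k₀] in
/-- **Conversely, a type induced from `k₀` has signature `(n, 0)` or `(0, n)`** over each `ψ`.
[cite: Dodson1984, §3.1.1 (`f = 0`)] [cite: Shimura1998, §8.4 (1)] -/
theorem ncard_inter_fibre_inducedCMType_eq_or (Ψ₀ : CMType k₀) (ψ : k₀ →+* ℂ) :
    {φ : K →+* ℂ | φ ∈ (inducedCMType (algebraMap k₀ K) Ψ₀).1 ∧ φ.comp (algebraMap k₀ K) = ψ}.ncard = finrank k₀ K ∨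
      {φ : K →+* ℂ | φ ∈ (inducedCMType (algebraMap k₀ K) Ψ₀).1 ∧ φ.comp (algebraMap k₀ K) = ψ}.ncard = 0 := by
  by_cases hψ : ψ ∈ Ψ₀.1
  · left
    rw [← ncard_fibre_eq_finrank k₀ ψ]
    congr 1
    ext φ
    simp only [Set.mem_setOf_eq, mem_inducedCMType_iff, and_iff_right_iff_imp]
    intro h
    rwa [h]
  · right
    rw [Set.ncard_eq_zero]
    ext φ
    simp only [Set.mem_setOf_eq, mem_inducedCMType_iff, Set.mem_empty_iff_false, iff_false, not_and]
    intro h1 h2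
    rw [h2] at h1
    exact hψ h1

omit [IsTotallyComplex k₀] in
/-- **Signature `(1, n − 1)` over `ψ` is the same thing as a special element above `ψ`** (Howard: «a unique
`φ^sp ∈ Φ` whose restriction to `K₀` is `ῑ`»). [cite: Howard2012, §3.1] -/
theorem ncard_inter_fibre_eq_one_iff_exists_special (Φ : CMType K) (ψ : k₀ →+* ℂ) :
    {φ : K →+* ℂ | φ ∈ Φ.1 ∧ φ.comp (algebraMap k₀ K) = ψ}.ncard = 1 ↔
      ∃ σ₀ ∈ Φ.1, σ₀.comp (algebraMap k₀ K) = ψ ∧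
        ∀ φ ∈ Φ.1, φ.comp (algebraMap k₀ K) = σ₀.comp (algebraMap k₀ K) → φ = σ₀ := by
  rw [Set.ncard_eq_one]
  constructor
  · rintro ⟨σ₀, hσ₀⟩
    have hmem : σ₀ ∈ {φ : K →+* ℂ | φ ∈ Φ.1 ∧ φ.comp (algebraMap k₀ K) = ψ} := by rw [hσ₀]; rfl
    refine ⟨σ₀, hmem.1, hmem.2, fun φ hφ hφψ => ?_⟩
    have : φ ∈ {φ : K →+* ℂ | φ ∈ Φ.1 ∧ φ.comp (algebraMap k₀ K) = ψ} := ⟨hφ, hφψ.trans hmem.2⟩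
    rw [hσ₀] at this
    exact this
  · rintro ⟨σ₀, hσ₀, hψ, hsp⟩
    refine ⟨σ₀, Set.ext fun φ => ⟨fun h => hsp φ h.1 (h.2.trans hψ.symm), fun h => ?_⟩⟩
    rw [Set.mem_singleton_iff.1 h]
    exact ⟨hσ₀, hψ⟩

variable [IsCMField K]

/-- **The types of signature `(1, n − 1)` or `(n − 1, 1)` form ONE Galois class** (`[K : ℚ] ≥ 6`): both have a special
element (above `ψ`, resp. `ψ̄`), and the special types are one class (`galoisRel_iff_exists_special`).
[cite: Howard2012, §3.1] [cite: Dodson1984, §3.1.1 Theorem (proof)] -/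
theorem galoisRel_of_ncard_inter_fibre_mem_pair (hk₀ : finrank ℚ k₀ = 2) (h6 : 6 ≤ finrank ℚ K) {Φ Ψ : CMType K}
    (ψ : k₀ →+* ℂ)
    (hΦ : {φ : K →+* ℂ | φ ∈ Φ.1 ∧ φ.comp (algebraMap k₀ K) = ψ}.ncard = 1 ∨
      {φ : K →+* ℂ | φ ∈ Φ.1 ∧ φ.comp (algebraMap k₀ K) = ψ}.ncard = finrank k₀ K - 1)
    (hΨ : {φ : K →+* ℂ | φ ∈ Ψ.1 ∧ φ.comp (algebraMap k₀ K) = ψ}.ncard = 1 ∨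
      {φ : K →+* ℂ | φ ∈ Ψ.1 ∧ φ.comp (algebraMap k₀ K) = ψ}.ncard = finrank k₀ K - 1) :
    (cmTypeGaloisSetoid K).r Φ Ψ := by
  have hn : 3 ≤ finrank k₀ K := by rw [finrank_eq_finrank_div_two k₀ hk₀]; omega
  -- a special element of `Φ` (above `ψ` or above `ψ̄`)
  have hspΦ : ∃ σ₀ ∈ Φ.1, ∀ φ ∈ Φ.1, φ.comp (algebraMap k₀ K) = σ₀.comp (algebraMap k₀ K) → φ = σ₀ := by
    rcases hΦ with h | h
    · obtain ⟨σ₀, hσ₀, -, hsp⟩ := (ncard_inter_fibre_eq_one_iff_exists_special k₀ Φ ψ).1 h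
      exact ⟨σ₀, hσ₀, hsp⟩
    · have h' : {φ : K →+* ℂ | φ ∈ Φ.1 ∧
          φ.comp (algebraMap k₀ K) = ComplexEmbedding.conjugate ψ}.ncard = 1 := by
        rw [ncard_inter_fibre_conjugate_eq, h]; omega
      obtain ⟨σ₀, hσ₀, -, hsp⟩ := (ncard_inter_fibre_eq_one_iff_exists_special k₀ Φ _).1 h'
      exact ⟨σ₀, hσ₀, hsp⟩
  have hspΨ : ∃ σ₁ ∈ Ψ.1, ∀ φ ∈ Ψ.1, φ.comp (algebraMap k₀ K) = σ₁.comp (algebraMap k₀ K) → φ = σ₁ := by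
    rcases hΨ with h | h
    · obtain ⟨σ₁, hσ₁, -, hsp⟩ := (ncard_inter_fibre_eq_one_iff_exists_special k₀ Ψ ψ).1 h
      exact ⟨σ₁, hσ₁, hsp⟩
    · have h' : {φ : K →+* ℂ | φ ∈ Ψ.1 ∧
          φ.comp (algebraMap k₀ K) = ComplexEmbedding.conjugate ψ}.ncard = 1 := by
        rw [ncard_inter_fibre_conjugate_eq, h]; omega
      obtain ⟨σ₁, hσ₁, -, hsp⟩ := (ncard_inter_fibre_eq_one_iff_exists_special k₀ Ψ _).1 h'
      exact ⟨σ₁, hσ₁, hsp⟩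
  obtain ⟨σ₀, hσ₀, hsp₀⟩ := hspΦ
  exact (galoisRel_iff_exists_special k₀ hk₀ hσ₀ hsp₀ Ψ).2 hspΨ

/-- **A type of signature `(a, n − a)` with `2 ≤ a ≤ n − 2` is neither induced from `k₀` nor special** — it is not
Galois equivalent to any type of signature in `{0, 1, n − 1, n}`. [cite: Dodson1984, §3.1.1 Theorem (proof)] -/
theorem not_galoisRel_of_two_le_ncard_inter_fibre (hk₀ : finrank ℚ k₀ = 2) {Φ Ψ : CMType K} (ψ : k₀ →+* ℂ)
    (h2 : 2 ≤ {φ : K →+* ℂ | φ ∈ Φ.1 ∧ φ.comp (algebraMap k₀ K) = ψ}.ncard)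
    (h2' : {φ : K →+* ℂ | φ ∈ Φ.1 ∧ φ.comp (algebraMap k₀ K) = ψ}.ncard + 2 ≤ finrank k₀ K)
    (hΨ : {φ : K →+* ℂ | φ ∈ Ψ.1 ∧ φ.comp (algebraMap k₀ K) = ψ}.ncard ≤ 1 ∨
      finrank k₀ K - 1 ≤ {φ : K →+* ℂ | φ ∈ Ψ.1 ∧ φ.comp (algebraMap k₀ K) = ψ}.ncard) :
    ¬ (cmTypeGaloisSetoid K).r Φ Ψ := by
  refine not_galoisRel_of_ncard_inter_fibre_ne k₀ hk₀ ψ ?_ ?_ <;> omega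

end Extreme

/-! ## §6 The reflex field sees `k₀` exactly when the signature is unbalanced -/

section Reflex

/-- The image of an embedding of a number field is finite over `ℚ`. [folklore] -/
private theorem finiteDimensional_fieldRange_sg {E : Type} [Field E] [NumberField E] (s : E →+* ℂ) :
    FiniteDimensional ℚ s.toRatAlgHom.fieldRange :=
  LinearEquiv.finiteDimensional (AlgEquiv.ofInjectiveField s.toRatAlgHom).toLinearEquiv

/-- `ℚ(tr_Φ(K))` is a finite extension of `ℚ`. [folklore] -/
private theorem finiteDimensional_traceField_sg (Φ : CMType K) : FiniteDimensional ℚ (traceField Φ) :=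
  Module.finite_of_finrank_pos (finrank_traceField_pos Φ)

variable [IsCMField K] [IsTotallyComplex k₀]

/-- **Unbalanced signature (`2a ≠ n`) ⟹ the reflex field contains `ψ(k₀)`**: an automorphism of `ℂ` fixing
`K* = ℚ(tr_Φ)` fixes `Φ`, hence preserves the `ψ`-multiplicity; if it moved `ψ` to `ψ̄` the multiplicity would become
`n − a ≠ a`.  (For the unitary signatures `(p, q)`, `p ≠ q`, the reflex field of the Shimura datum contains the
imaginary quadratic field.) [cite: Dodson1984, §3.1.1 Theorem (proof, p. 12)] [cite: Shimura1998, §8.3 Prop. 28]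
[cite: Howard2012, §3.1] -/
theorem fieldRange_le_traceField_of_two_mul_ncard_ne (hk₀ : finrank ℚ k₀ = 2) (Φ : CMType K) (ψ : k₀ →+* ℂ)
    (h : 2 * {φ : K →+* ℂ | φ ∈ Φ.1 ∧ φ.comp (algebraMap k₀ K) = ψ}.ncard ≠ finrank k₀ K) :
    ψ.toRatAlgHom.fieldRange ≤ traceField Φ := by
  haveI := finiteDimensional_fieldRange_sg ψ
  haveI := finiteDimensional_traceField_sg Φ
  intro z hz
  by_contra hzM
  obtain ⟨τ, hτM, hτz⟩ := exists_ringEquiv_apply_ne_of_not_mem (M := traceField Φ) (N := ψ.toRatAlgHom.fieldRange)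
    hz hzM
  -- `τ` fixes `K*`, hence `Φ`: `τ⁻¹Φ = Φ`
  have hfix : ∀ χ : K →+* ℂ, τ • χ ∈ Φ.1 ↔ χ ∈ Φ.1 :=
    (forall_smul_mem_iff_iff_forall_apply_traceField_eq τ Φ).2 hτM
  have hinv : cmTypeSmul τ⁻¹ Φ = Φ := by
    refine Subtype.ext (Set.ext fun χ => ?_)
    rw [cmTypeSmul_val, Set.mem_smul_set_iff_inv_smul_mem, inv_inv]
    exact hfix χ
  -- so `τψ ∈ {ψ, ψ̄}` must be `ψ`
  have hτψ : τ • ψ = ψ := by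
    rcases eq_or_eq_conjugate_sg k₀ hk₀ ψ (τ • ψ) with h1 | h1
    · exact h1
    · exfalso
      have hcount := ncard_inter_fibre_cmTypeSmul k₀ τ⁻¹ Φ ψ
      rw [hinv, inv_inv, h1, ncard_inter_fibre_conjugate_eq] at hcount
      have hle := ncard_inter_fibre_le k₀ Φ ψ
      omega
  obtain ⟨x, rfl⟩ := AlgHom.mem_fieldRange.1 hz
  apply hτz
  change τ (ψ x) = ψ x
  rw [← ringEquiv_smul_apply τ ψ x, hτψ]

/-- In particular **`ψ(k₀) ⊆ K*` for every type with a special element** (signature `(1, n − 1)`, `n ≥ 3`) — the first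
step of «`K_Φ ⊇ K₀`». [cite: Howard2012, §3.1] -/
theorem fieldRange_le_traceField_of_special (hk₀ : finrank ℚ k₀ = 2) (h6 : 6 ≤ finrank ℚ K) {Φ : CMType K}
    {σ₀ : K →+* ℂ} (hσ₀ : σ₀ ∈ Φ.1)
    (hsp : ∀ φ ∈ Φ.1, φ.comp (algebraMap k₀ K) = σ₀.comp (algebraMap k₀ K) → φ = σ₀) :
    (σ₀.comp (algebraMap k₀ K)).toRatAlgHom.fieldRange ≤ traceField Φ := by
  refine fieldRange_le_traceField_of_two_mul_ncard_ne k₀ hk₀ Φ _ ?_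
  rw [(ncard_inter_fibre_eq_one_iff_exists_special k₀ Φ _).2 ⟨σ₀, hσ₀, rfl, hsp⟩,
    finrank_eq_finrank_div_two k₀ hk₀]
  omega

/-- **Balanced signature is forced when `K*` misses `ψ(k₀)`**: if some element of `ψ(k₀)` lies outside the reflex field
then `2a = n` (the type is «of Weil type» relative to `k₀`). [cite: Dodson1984, §3.1.1 Theorem (proof, p. 12)]
[cite: Shimura1998, §8.3 Prop. 28] -/
theorem two_mul_ncard_inter_fibre_eq_of_not_le (hk₀ : finrank ℚ k₀ = 2) (Φ : CMType K) (ψ : k₀ →+* ℂ)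
    (h : ¬ ψ.toRatAlgHom.fieldRange ≤ traceField Φ) :
    2 * {φ : K →+* ℂ | φ ∈ Φ.1 ∧ φ.comp (algebraMap k₀ K) = ψ}.ncard = finrank k₀ K := by
  by_contra hne
  exact h (fieldRange_le_traceField_of_two_mul_ncard_ne k₀ hk₀ Φ ψ hne)

end Reflex

end Literature.NumberTheory.ComplexMultiplication

end
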